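import Mathlib
import Summits.Ventures.PercRepro2.SwOutMultiRootThm

/-!
# THE EXEMPTION INDUCTION: the multi-junction class from the multi-root core cube (blind cell
PercRepro2, night-4 g34, 2026-08-29; proofs/NIGHT4-G34.md §7)

A junction `u` of a class is ESCAPING at a side point when its hull leaves the region.  Under the
hypothesis (★) — every escaping junction lies in the red cluster of `l` (at the graph level, where
the only outside vertex is `l`: a junction that cannot escape in blue, e.g. a blue neighbour of the
mark of the mark step, whose pattern forbids `u ∈ C_B(l)`) — the side of a class with the
junctions `J` is the disjoint union, over the subsets `T ⊆ J`, of the NON-ESCAPING PARTS of the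
sides with the junctions of `T` EXEMPT (forced into `C_R(l)` by `𝓤 ∩ {S ∣ T ⊆ S}`) and the
junctions of `J ∖ T` as roots: the multi-root core cube theorem `rigidOK_g_of_multiRoot` on each
part gives the rigid counting inequality on the whole side — **`rigidOK_g_of_junctions_star`** —
with NO hypothesis on the neighbourhoods of the junctions (adjacent junctions after g29's
subdivision of the edge, mixed junctions, any number of them).

Census (mining/night-4/g34/mrcube.py): the decomposition is verified with Hall on every cube of
every part on the 364 of 387 uncovered mark-step classes at `n = 6` whose junctions satisfy (★)
(3,127 cubes, 4,621 points, 0 failures); the 23 classes with a blue-escaping junction are the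
successor's.
-/

namespace Summit.Ventures.PercRepro2

namespace LocRows

open Hull

variable {V : Type*} {E : Type*} [Fintype E] [DecidableEq E]

open scoped Classical

variable {ends : E → Sym2 V} {U : Set V} {ξ : Config E} {l h : V}
  {𝓤 𝓓 𝓓'' : Set (Set V)} {X : Set V} {𝓤' : Set (Set V)} {F : V → Prop}

section Exempt

variable {J : Finset V}

/-- The escaping set of a side point: the junctions in the red cluster of `l`. -/
noncomputable def escSet (ends : E → Sym2 V) (J : Finset V) (l : V) (ζ : Config E) : Finset V :=
  J.filter fun u => u ∈ cluster ends ζ l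

omit [Fintype E] [DecidableEq E] in
/-- A non-escaping junction is not in the red cluster of `l`. -/
lemma notMem_cluster_l_of_hull_subset (hl : l ∉ U) {ζ : Config E} {u : V}
    (hu : hull ends ζ u ⊆ U) : u ∉ cluster ends ζ l := fun h' => hl (hu (Or.inl (conn_symm h')))

/-- The `T`-exempt family is an upper set. -/
lemma isUpperSet_exempt (h𝓤 : IsUpperSet 𝓤) (T : Finset V) :
    IsUpperSet (𝓤 ∩ {S : Set V | ∀ u ∈ T, u ∈ S}) :=
  h𝓤.inter fun _ _ hle h' u hu => hle (h' u hu)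

variable (h𝓤 : IsUpperSet 𝓤) (h𝓓 : IsLowerSet 𝓓) (h𝓓'' : IsLowerSet 𝓓'') (h𝓤' : IsUpperSet 𝓤')
  (hl : l ∉ U)
  (hroot : ∀ e r x, r ∈ insert h (↑J : Set V) → ends e = s(r, x) → x ∉ insert h (↑J : Set V))
  (hF : ∀ x, F x → ∀ S ∈ 𝓤, x ∈ S)
  (hout : ∀ x ∈ U, x ≠ h → x ∉ J →
    F x ∨ x ∈ X ∨ (∃ e y, ends e = s(x, y) ∧ y ∉ U) ∨ (∀ e, x ∉ ends e))
  (hX : ∀ x ∈ X, x ∈ U → ∀ e, x ∈ ends e → ends e = s(x, x))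
  (hhX : h ∉ X) (hJX : ∀ u ∈ J, u ∉ X)
  (hstar : ∀ ζ ∈ gOutSide ends l h 𝓤 𝓓 𝓓'' X 𝓤' U ξ, ∀ u ∈ J,
    ¬ hull ends ζ u ⊆ U → u ∈ cluster ends ζ l)

include hl hstar in
/-- **The fibre of the escaping set `T`** is the non-escaping part (roots `h` and `J ∖ T`) of the
side with the junctions of `T` exempt. -/
lemma mem_fibre_iff {T : Finset V} (hT : T ⊆ J) {ζ : Config E} :
    (ζ ∈ gOutSide ends l h 𝓤 𝓓 𝓓'' X 𝓤' U ξ ∧ escSet ends J l ζ = T) ↔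
      (ζ ∈ gOutSide ends l h (𝓤 ∩ {S | ∀ u ∈ T, u ∈ S}) 𝓓 𝓓'' X 𝓤' U ξ ∧
        ∀ r ∈ insert h (↑(J \ T) : Set V), hull ends ζ r ⊆ U) := by
  constructor
  · rintro ⟨hζ, hesc⟩
    have hQ := (mem_gOutSide.1 hζ).1
    have hcl := (mem_gOutSide.1 hζ).2
    rw [mem_gTypedQ] at hQ
    obtain ⟨hh, hA, hB, hRh, hX', hBh⟩ := hQ
    refine ⟨mem_gOutSide.2 ⟨mem_gTypedQ.2 ⟨hh, ⟨hA, fun u hu => ?_⟩, hB, hRh, hX', hBh⟩, hcl⟩, ?_⟩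
    · rw [← hesc] at hu
      exact (Finset.mem_filter.1 hu).2
    · intro r hr
      rcases hr with rfl | hr
      · exact (mem_outClass.1 hcl).2
      · rw [Finset.mem_coe, Finset.mem_sdiff] at hr
        by_contra hne
        have := hstar ζ hζ r hr.1 hne
        exact hr.2 (hesc ▸ Finset.mem_filter.2 ⟨hr.1, this⟩)
  · rintro ⟨hζ, hne⟩
    have hQ := (mem_gOutSide.1 hζ).1
    have hcl := (mem_gOutSide.1 hζ).2
    rw [mem_gTypedQ] at hQ
    obtain ⟨hh, ⟨hA, hTA⟩, hB, hRh, hX', hBh⟩ := hQ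
    refine ⟨mem_gOutSide.2 ⟨mem_gTypedQ.2 ⟨hh, hA, hB, hRh, hX', hBh⟩, hcl⟩, ?_⟩
    ext u
    simp only [escSet, Finset.mem_filter]
    constructor
    · rintro ⟨huJ, hul⟩
      by_contra huT
      have hu : u ∈ insert h (↑(J \ T) : Set V) := Or.inr (by
        rw [Finset.mem_coe, Finset.mem_sdiff]; exact ⟨huJ, huT⟩)
      exact notMem_cluster_l_of_hull_subset hl (hne u hu) hul
    · intro huT
      exact ⟨hT huT, hTA u huT⟩

include h𝓤 h𝓓 h𝓓'' h𝓤' hl hroot hF hout hX hhX hJX hstar in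
/-- **THE MULTI-JUNCTION CLASS UNDER (★)**: the rigid counting inequality on the general doubly
typed side of every class of a region with the junctions `J` (no edge joins two of `{h} ∪ J`, no
loop at them, every other vertex of `U` exempt, in `X`, with an outside edge, or isolated; `X`
avoids `{h} ∪ J`), provided every escaping junction lies in the red cluster of `l` (★). -/
theorem rigidOK_g_of_junctions_star {𝓔 : Set (Set E)} (h𝓔 : IsUpperSet 𝓔) :
    ((gOutSide ends l h 𝓤 𝓓 𝓓'' X 𝓤' U ξ).filter fun ζ => redEdges ends ζ h ∈ 𝓔).card ≤
      ((gOutSide ends l h 𝓤 𝓓 𝓓'' X 𝓤' U ξ).filter fun ζ => blueEdges ends ζ h ∈ 𝓔).card := by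
  set C := gOutSide ends l h 𝓤 𝓓 𝓓'' X 𝓤' U ξ with hC
  have hmap : ∀ (P' : Config E → Prop) [DecidablePred P'], ∀ ζ ∈ C.filter P',
      escSet ends J l ζ ∈ J.powerset :=
    fun _ _ _ _ => Finset.mem_powerset.2 (Finset.filter_subset _ _)
  rw [Finset.card_eq_sum_card_fiberwise (hmap (fun ζ => redEdges ends ζ h ∈ 𝓔)),
    Finset.card_eq_sum_card_fiberwise (hmap (fun ζ => blueEdges ends ζ h ∈ 𝓔))]
  refine Finset.sum_le_sum fun T hT => ?_
  have hTJ : T ⊆ J := Finset.mem_powerset.1 hT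
  have hfib : ∀ (P' : Config E → Prop) [DecidablePred P'],
      (C.filter P').filter (fun ζ => escSet ends J l ζ = T) =
        (gOutSide ends l h (𝓤 ∩ {S | ∀ u ∈ T, u ∈ S}) 𝓓 𝓓'' X 𝓤' U ξ).filter
          (fun ζ => (∀ r ∈ insert h (↑(J \ T) : Set V), hull ends ζ r ⊆ U) ∧ P' ζ) := by
    intro P' _
    ext ζ
    simp only [Finset.mem_filter]
    constructor
    · rintro ⟨⟨hζ, hP⟩, hesc⟩
      obtain ⟨h1, h2⟩ := (mem_fibre_iff hl hstar hTJ).1 ⟨hζ, hesc⟩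
      exact ⟨h1, h2, hP⟩
    · rintro ⟨h1, h2, hP⟩
      obtain ⟨hζ, hesc⟩ := (mem_fibre_iff hl hstar hTJ).2 ⟨h1, h2⟩
      exact ⟨⟨hζ, hP⟩, hesc⟩
  rw [hfib (fun ζ => redEdges ends ζ h ∈ 𝓔), hfib (fun ζ => blueEdges ends ζ h ∈ 𝓔)]
  -- the multi-root core cube theorem with the roots `h` and `J ∖ T`, the junctions of `T` exempt
  have hsub : insert h (↑(J \ T) : Set V) ⊆ insert h (↑J : Set V) := by
    rintro r (rfl | hr)
    · exact Or.inl rfl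
    · rw [Finset.mem_coe, Finset.mem_sdiff] at hr
      exact Or.inr (Finset.mem_coe.2 hr.1)
  refine rigidOK_g_of_multiRoot (R := insert h (↑(J \ T) : Set V)) (F := fun x => F x ∨ x ∈ T)
    (isUpperSet_exempt h𝓤 T) h𝓓 h𝓓'' h𝓤' hl (Or.inl rfl) ?_ ?_ ?_ hX ?_ h𝓔
  · intro e r x hr hrx hx
    exact hroot e r x (hsub hr) hrx (hsub hx)
  · rintro x (hx | hx) S ⟨hS, hTS⟩
    · exact hF x hx S hS
    · exact hTS x hx
  · intro x hxU hxR
    have hxh : x ≠ h := fun h' => hxR (h' ▸ Or.inl rfl)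
    by_cases hxJ : x ∈ J
    · have hxT : x ∈ T := by
        by_contra hxT
        exact hxR (Or.inr (by rw [Finset.mem_coe, Finset.mem_sdiff]; exact ⟨hxJ, hxT⟩))
      exact Or.inl (Or.inr hxT)
    · rcases hout x hxU hxh hxJ with hf | hxX | hout' | hiso
      · exact Or.inl (Or.inl hf)
      · exact Or.inr (Or.inl hxX)
      · exact Or.inr (Or.inr (Or.inl hout'))
      · exact Or.inr (Or.inr (Or.inr hiso))
  · rintro r (rfl | hr)
    · exact hhX
    · rw [Finset.mem_coe, Finset.mem_sdiff] at hr
      exact hJX r hr.1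

end Exempt

end LocRows

end Summit.Ventures.PercRepro2
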